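import Summits.CriticalPhenomena.PercolationContinuityZ3.Theorems.PercNearOneGluingNoHeavyQuantFarCycleBlockLaw
import HarnessLib

/-!
# QUANT lane R8, front "FAR beyond trees", layer one — PENDANT CYCLE BLOCKS V: THE HUB-DECOUPLED WEIGHTS (`Block.cdecouple`): the cycle is
# replaced by independent stems `s(c, cyc j)` of weight `m_j = P_w(c ↔ cyc j in the cycle)`, every hub rides along; its block numbers are
# `hProd`, `tProd`

builds on p205010 (kernel theorem, internal audit signed; external expert review pending)

Support file (`--supports stmt-CriticalPhenomena-4575`), seat `prim-quant-p1` (gen 22); memo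
`run/shared/lean/prim/quant/prim-quant-p1-g22/FOR-LEAD-KHUB.md` §4.  Standard axioms; no sorries; one definition of weights (`Block.cdecouple`)
plus bookkeeping statistics.

* `Block.cdecouple L cyc S Z w`: `w` off `Z` and on every hub's pairs; the STEM `s(cyc 0, cyc j)` (`1 ≤ j < L`) gets `Block.stem` weight
  `m_j = P_w(c ↔ cyc j in core)` (`= a_j + b_j − a_j b_j`, `Block.real_stem_open`); every other pair meeting `Z` gets `0`.  It hangs `Z` at `c` and
  each `S j` at `cyc j` (`Block.cdecouple_hangZ/hangS`), keeps the hub laws (`Block.hz/hs/hd_cdecouple`), and almost surely its open core pairs are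
  stems (`Block.real_congr_cd`), so that `c ↔ cyc j in core ⟺ stem j open` (`Block.coreReach_iff_stem`) and the block count is
  `Block.stemCount = Σ_j 𝟙[stem j open]·W_j` (`Block.real_card_on_eq_stemCount`); `Block.real_stem_open`: `P_{w'}(stem j open) = a_j ⊕ b_j`.
The laws of the stem count (`hProd`, `tProd`) follow in `…QuantFarCycleBlockStems`.
[cite: Grimmett1999, §1.3 p. 10; §2.2]; the construction [this work].
-/

noncomputable section

namespace Summit.CriticalPhenomena.PercolationContinuityZ3.Theorems

namespace Quant

namespace Block

open Finset MeasureTheory Set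
open Literature.Probability.LatticeModels
open Literature.Probability.Percolation
open Summit.CriticalPhenomena.PercolationContinuityZ3.Theorems.HairyCycle (cycE CW CCW RC)
open Bundle (offZ avoid)
open scoped Classical

variable {n : ℕ}

/-! ## The decoupled weights -/

/-- **The hub-decoupled weights of a pendant cycle block**: `w` off `Z` and on the hub pairs, stems `s(cyc 0, cyc j)` of weight
`m_j = P_w(cyc 0 ↔ cyc j in core)`, all other pairs meeting `Z` get `0`. [this work] -/
def cdecouple (L : ℕ) (cyc : ℕ → Fin n) (S : ℕ → Finset (Fin n)) (Z : Finset (Fin n)) (w : Sym2 (Fin n) → unitInterval) :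
    Sym2 (Fin n) → unitInterval := fun e =>
  if e ∈ avoid Z then w e
  else if h : ∃ j, (1 ≤ j ∧ j < L) ∧ e = s(cyc 0, cyc j) then stem (cyc 0) (cyc (Nat.find h)) Z (hubs (cpos L) S) w
  else if ∃ j, (1 ≤ j ∧ j < L) ∧ e ∈ hubPairs (S j) (cyc j) then w e else 0

/-- `Σ_{1 ≤ j < L} 𝟙[stem j open]·W_j`: the block count of the decoupled block (almost surely). [this work] -/
def stemCount (L : ℕ) (cyc : ℕ → Fin n) (S : ℕ → Finset (Fin n)) (A : Finset (Fin n)) (ω : BondConfig (Fin n)) : ℕ :=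
  ∑ j ∈ cpos L, if s(cyc 0, cyc j) ∈ ω then hubCount cyc S A j ω else 0

section CycleBlock

variable {L : ℕ} {cyc : ℕ → Fin n} {S : ℕ → Finset (Fin n)} {Z : Finset (Fin n)} (H : IsCycleBlock L cyc S Z)
  (w : Sym2 (Fin n) → unitInterval)
include H

/-- The stem to `cyc j` determines `j`. [this work] -/
theorem stem_index_unique {j j' : ℕ} (hj : 1 ≤ j ∧ j < L) (hj' : 1 ≤ j' ∧ j' < L) (h : s(cyc 0, cyc j) = s(cyc 0, cyc j')) : j = j' := by
  have hL := H.hL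
  rcases Sym2.eq_iff.1 h with ⟨-, h2⟩ | ⟨h1, -⟩
  · exact H.hcyc j j' hj.2 hj'.2 h2
  · have := H.hcyc 0 j' (by omega) hj'.2 h1; omega

/-- A stem is not a hub pair. [this work] -/
theorem stem_notMem_hubPairs {i j : ℕ} (hi : i < L) (hj : 1 ≤ j ∧ j < L) : s(cyc 0, cyc i) ∉ hubPairs (S j) (cyc j) := by
  have hL := H.hL
  intro h
  obtain ⟨⟨z, hz, hze⟩, -⟩ := (Finset.mem_filter.1 h).2
  rcases Sym2.mem_iff.1 hze with rfl | rfl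
  · exact H.cycS 0 j (by omega) hj.1 hj.2 hz
  · exact H.cycS i j hi hj.1 hj.2 hz

/-- A stem does not avoid `Z`. [this work] -/
theorem stem_not_avoid {j : ℕ} (hj : 1 ≤ j ∧ j < L) : s(cyc 0, cyc j) ∉ avoid Z :=
  fun h => (Finset.mem_filter.1 h).2 (cyc j) (H.cycZ j hj.1 hj.2) (Sym2.mem_mk_right _ _)

omit H in
/-- `cdecouple` agrees with `w` off the block. [this work] -/
theorem cdecouple_of_avoid {e : Sym2 (Fin n)} (he : e ∈ avoid Z) : cdecouple L cyc S Z w e = w e := by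
  simp only [cdecouple, if_pos he]

/-- `cdecouple` on a stem. [this work] -/
theorem cdecouple_stem {j : ℕ} (hj : 1 ≤ j ∧ j < L) :
    cdecouple L cyc S Z w s(cyc 0, cyc j) = stem (cyc 0) (cyc j) Z (hubs (cpos L) S) w := by
  have hex : ∃ j', (1 ≤ j' ∧ j' < L) ∧ s(cyc 0, cyc j) = s(cyc 0, cyc j') := ⟨j, hj, rfl⟩
  simp only [cdecouple, if_neg (stem_not_avoid H hj), dif_pos hex]
  have hspec := Nat.find_spec hex
  rw [← stem_index_unique H hj hspec.1 hspec.2]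

/-- `cdecouple` keeps the hub weights. [this work] -/
theorem cdecouple_hub {j : ℕ} (hj : 1 ≤ j ∧ j < L) {e : Sym2 (Fin n)} (he : e ∈ hubPairs (S j) (cyc j)) : cdecouple L cyc S Z w e = w e := by
  have h1 : e ∉ avoid Z := by
    intro h
    obtain ⟨⟨z, hz, hze⟩, -⟩ := (Finset.mem_filter.1 he).2
    exact (Finset.mem_filter.1 h).2 z (H.SZ j hj.1 hj.2 hz) hze
  have h2 : ¬ ∃ i, (1 ≤ i ∧ i < L) ∧ e = s(cyc 0, cyc i) := by
    rintro ⟨i, hi, rfl⟩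
    exact stem_notMem_hubPairs H hi.2 hj he
  have h3 : ∃ j, (1 ≤ j ∧ j < L) ∧ e ∈ hubPairs (S j) (cyc j) := ⟨j, hj, he⟩
  simp only [cdecouple, if_neg h1, dif_neg h2, if_pos h3]

omit H in
/-- `cdecouple` vanishes on every other pair. [this work] -/
theorem cdecouple_zero {e : Sym2 (Fin n)} (h1 : e ∉ avoid Z) (h2 : ¬ ∃ j, (1 ≤ j ∧ j < L) ∧ e = s(cyc 0, cyc j))
    (h3 : ¬ ∃ j, (1 ≤ j ∧ j < L) ∧ e ∈ hubPairs (S j) (cyc j)) : (cdecouple L cyc S Z w e : ℝ) = 0 := by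
  simp only [cdecouple, if_neg h1, dif_neg h2, if_neg h3]; rfl

/-- The decoupled weights hang `Z` at `c`. [this work] -/
theorem cdecouple_hangZ : ∀ x y : Fin n, x ≠ y → x ∈ Z → y ∉ Z → y ≠ cyc 0 → (cdecouple L cyc S Z w s(x, y) : ℝ) = 0 := by
  intro x y _ hx hy hyc
  refine cdecouple_zero w (not_avoid_of_mem hx) ?_ ?_
  · rintro ⟨j, hj, h⟩
    rcases Sym2.eq_iff.1 h with ⟨h1, -⟩ | ⟨-, h2⟩
    · exact H.cZ (h1 ▸ hx)
    · exact hyc h2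
  · rintro ⟨j, hj, h⟩
    exact hy (mem_Z_of_hubPair H hj.1 hj.2 h (Sym2.mem_mk_right x y))

/-- The decoupled weights hang `S j` at `cyc j`. [this work] -/
theorem cdecouple_hangS {j : ℕ} (hj1 : 1 ≤ j) (hjL : j < L) :
    ∀ x y : Fin n, x ≠ y → x ∈ S j → y ∉ S j → y ≠ cyc j → (cdecouple L cyc S Z w s(x, y) : ℝ) = 0 := by
  have hL := H.hL
  intro x y _ hx hy hyc
  refine cdecouple_zero w (not_avoid_of_mem (H.SZ j hj1 hjL hx)) ?_ ?_
  · rintro ⟨i, hi, h⟩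
    rcases Sym2.eq_iff.1 h with ⟨h1, -⟩ | ⟨h1, -⟩
    · exact H.cycS 0 j (by omega) hj1 hjL (h1 ▸ hx)
    · exact H.cycS i j hi.2 hj1 hjL (h1 ▸ hx)
  · rintro ⟨i, hi, h⟩
    obtain ⟨-, hin⟩ := (Finset.mem_filter.1 h).2
    have hxi : x ∈ S i := by
      rcases hin x (Sym2.mem_mk_left x y) with h' | h'
      · exact h'
      · exact absurd (h' ▸ hx) (H.cycS i j hi.2 hj1 hjL)
    have hij : i = j := by
      by_contra hij; exact Finset.disjoint_left.1 (H.disj i j hi.1 hi.2 hj1 hjL hij) hxi hx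
    subst hij
    rcases hin y (Sym2.mem_mk_right x y) with h' | h'
    · exact hy h'
    · exact hyc h'

/-! ## Almost surely the open core pairs are stems -/

/-- The exceptional pairs of the decoupled block: non-loop pairs meeting `Z` that are neither stems nor hub pairs. [this work] -/
def cdForb (L : ℕ) (cyc : ℕ → Fin n) (S : ℕ → Finset (Fin n)) (Z : Finset (Fin n)) : Finset (Sym2 (Fin n)) :=
  Finset.univ.filter fun e => ¬ e.IsDiag ∧ (∃ z ∈ Z, z ∈ e) ∧ (¬ ∃ j, (1 ≤ j ∧ j < L) ∧ e = s(cyc 0, cyc j)) ∧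
    ¬ ∃ j, (1 ≤ j ∧ j < L) ∧ e ∈ hubPairs (S j) (cyc j)

/-- Good configurations of the decoupled block. [this work] -/
def CdGood (L : ℕ) (cyc : ℕ → Fin n) (S : ℕ → Finset (Fin n)) (Z : Finset (Fin n)) (ω : BondConfig (Fin n)) : Prop :=
  Good (cyc 0) Z ω ∧ (∀ j, 1 ≤ j → j < L → Good (cyc j) (S j) ω) ∧
    ∀ e ∈ core Z (hubs (cpos L) S) ω, e.IsDiag ∨ ∃ j, (1 ≤ j ∧ j < L) ∧ e = s(cyc 0, cyc j)

omit H in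
/-- Every exceptional pair carries decoupled weight `0`. [this work] -/
theorem cdForb_vanish : ∀ e ∈ cdForb L cyc S Z, (cdecouple L cyc S Z w e : ℝ) = 0 := by
  intro e he
  obtain ⟨-, ⟨z, hz, hze⟩, h2, h3⟩ := (Finset.mem_filter.1 he).2
  exact cdecouple_zero w (fun h => (Finset.mem_filter.1 h).2 z hz hze) h2 h3

/-- Off the exceptional pairs the configuration is good. [this work] -/
theorem cdGood_of_forb {ω : BondConfig (Fin n)} (hω : ∀ e ∈ cdForb L cyc S Z, e ∉ ω) : CdGood L cyc S Z ω := by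
  have hL := H.hL
  have forb : ∀ x y : Fin n, x ≠ y → (x ∈ Z ∨ y ∈ Z) → (¬ ∃ j, (1 ≤ j ∧ j < L) ∧ s(x, y) = s(cyc 0, cyc j)) →
      (¬ ∃ j, (1 ≤ j ∧ j < L) ∧ s(x, y) ∈ hubPairs (S j) (cyc j)) → s(x, y) ∉ ω := by
    intro x y hxy hxZ hns hnh
    refine hω _ (Finset.mem_filter.2 ⟨Finset.mem_univ _, ?_, ?_, hns, hnh⟩)
    · rw [Sym2.mk_isDiag_iff]; exact hxy
    · rcases hxZ with h | h
      · exact ⟨x, h, Sym2.mem_mk_left _ _⟩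
      · exact ⟨y, h, Sym2.mem_mk_right _ _⟩
  refine ⟨?_, ?_, ?_⟩
  · intro x y hxy he hx hy
    by_contra hyc
    refine forb x y hxy (Or.inl hx) ?_ ?_ he
    · rintro ⟨j, hj, h⟩
      rcases Sym2.eq_iff.1 h with ⟨h1, -⟩ | ⟨-, h2⟩
      · exact H.cZ (h1 ▸ hx)
      · exact hyc h2
    · rintro ⟨j, hj, h⟩
      exact hy (mem_Z_of_hubPair H hj.1 hj.2 h (Sym2.mem_mk_right x y))
  · intro j hj1 hjL x y hxy he hx hy
    by_contra hyc
    refine forb x y hxy (Or.inl (H.SZ j hj1 hjL hx)) ?_ ?_ he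
    · rintro ⟨i, hi, h⟩
      rcases Sym2.eq_iff.1 h with ⟨h1, -⟩ | ⟨h1, -⟩
      · exact H.cycS 0 j (by omega) hj1 hjL (h1 ▸ hx)
      · exact H.cycS i j hi.2 hj1 hjL (h1 ▸ hx)
    · rintro ⟨i, hi, h⟩
      obtain ⟨-, hin⟩ := (Finset.mem_filter.1 h).2
      have hxi : x ∈ S i := by
        rcases hin x (Sym2.mem_mk_left x y) with h' | h'
        · exact h'
        · exact absurd (h' ▸ hx) (H.cycS i j hi.2 hj1 hjL)
      have hij : i = j := by
        by_contra hij; exact Finset.disjoint_left.1 (H.disj i j hi.1 hi.2 hj1 hjL hij) hxi hx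
      subst hij
      rcases hin y (Sym2.mem_mk_right x y) with h' | h'
      · exact hy h'
      · exact hyc h'
  · intro e he
    obtain ⟨heω, hz, havoid⟩ := he
    induction e using Sym2.ind with
    | h x y =>
      by_cases hxy : x = y
      · left; rw [Sym2.mk_isDiag_iff]; exact hxy
      · right
        by_contra hns
        refine forb x y hxy ?_ hns ?_ heω
        · obtain ⟨z, hz, hze⟩ := hz
          rcases Sym2.mem_iff.1 hze with rfl | rfl
          · exact Or.inl hz
          · exact Or.inr hz
        · rintro ⟨j, hj, h⟩
          obtain ⟨⟨z, hzS, hze⟩, -⟩ := (Finset.mem_filter.1 h).2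
          exact havoid z (mem_hubs.2 ⟨j, mem_cpos.2 hj, hzS⟩) hze

/-- Almost surely the decoupled configuration is good. [this work] -/
theorem real_congr_cd (U T : Set (BondConfig (Fin n))) (hUT : ∀ ω, CdGood L cyc S Z ω → (ω ∈ U ↔ ω ∈ T)) :
    (prodBernoulli (cdecouple L cyc S Z w)).real U = (prodBernoulli (cdecouple L cyc S Z w)).real T :=
  real_congr_of_vanish _ (cdForb L cyc S Z) (cdForb_vanish w) U T fun _ hω => hUT _ (cdGood_of_forb H hω)

/-- **On a good configuration `c ↔ cyc j` through the core iff the stem `s(c, cyc j)` is open.** [this work] -/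
theorem coreReach_iff_stem {ω : BondConfig (Fin n)} (hω : CdGood L cyc S Z ω) {j : ℕ} (hj : 1 ≤ j ∧ j < L) :
    core Z (hubs (cpos L) S) ω ∈ openConn (cyc 0) (cyc j) ↔ s(cyc 0, cyc j) ∈ ω := by
  have hL := H.hL
  have hcj : cyc 0 ≠ cyc j := fun h => by have := H.hcyc 0 j (by omega) hj.2 h; omega
  constructor
  · intro h
    obtain ⟨p⟩ := (h : (openGraph (core Z (hubs (cpos L) S) ω)).Reachable (cyc 0) (cyc j)).symm
    suffices key : ∀ (u v : Fin n) (_ : (openGraph (core Z (hubs (cpos L) S) ω)).Walk u v), u = cyc j → v = cyc 0 →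
        s(cyc 0, cyc j) ∈ ω from key _ _ p rfl rfl
    intro u v q
    cases q with
    | nil => intro hu hv; exact absurd (hv.symm.trans hu) hcj
    | cons hadj q' =>
      rename_i x
      intro hu _
      subst hu
      rw [openGraph_adj] at hadj
      obtain ⟨hcore, hne⟩ := hadj
      rcases hω.2.2 _ hcore with hdiag | ⟨i, hi, heq⟩
      · exact absurd (Sym2.mk_isDiag_iff.1 hdiag) hne
      · have hij : j = i := by
          rcases Sym2.eq_iff.1 heq with ⟨h1, -⟩ | ⟨h1, -⟩
          · exact absurd h1.symm hcj
          · exact H.hcyc j i hj.2 hi.2 h1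
        subst hij
        rw [heq] at hcore
        exact hcore.1
  · intro h
    have hadj : (openGraph (core Z (hubs (cpos L) S) ω)).Adj (cyc 0) (cyc j) := by
      rw [openGraph_adj]
      refine ⟨⟨h, ⟨cyc j, H.cycZ j hj.1 hj.2, Sym2.mem_mk_right _ _⟩, fun ℓ hℓ hmem => ?_⟩, hcj⟩
      rcases Sym2.mem_iff.1 hmem with rfl | rfl
      · exact cyc_notMem_hubs H (by omega) hℓ
      · exact cyc_notMem_hubs H hj.2 hℓ
    exact hadj.reachable

/-- **The block count of the decoupled block is the stem count** (good configurations). [this work] -/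
theorem card_on_eq_stemCount {ω : BondConfig (Fin n)} (hω : CdGood L cyc S Z ω) (A : Finset (Fin n)) :
    ((A ∩ Z).filter fun a => onZ Z ω ∈ openConn (cyc 0) a).card = stemCount L cyc S A ω := by
  have hgood : ∀ i ∈ cpos L, Good (cyc i) (S i) ω := fun i hi => hω.2.1 i (mem_cpos.1 hi).1 (mem_cpos.1 hi).2
  rw [card_on_eq_family (isHubFamily H) hgood (fun a ha => by
    obtain ⟨j, hj1, hjL, h⟩ := H.Zsub a (Finset.mem_inter.1 ha).2
    exact ⟨j, mem_cpos.2 ⟨hj1, hjL⟩, h⟩)]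
  unfold stemCount hubCount
  refine Finset.sum_congr rfl fun j hj => ?_
  rw [coreReach_iff_stem H hω (mem_cpos.1 hj)]

/-- Events read off the decoupled block count have the probability of the same events read off the stem count. [this work] -/
theorem real_card_on_eq_stemCount (A : Finset (Fin n)) (P : ℕ → Prop) :
    (prodBernoulli (cdecouple L cyc S Z w)).real {ω | P (((A ∩ Z).filter fun a => onZ Z ω ∈ openConn (cyc 0) a).card)} =
      (prodBernoulli (cdecouple L cyc S Z w)).real {ω | P (stemCount L cyc S A ω)} :=
  real_congr_cd H w _ _ fun ω hω => by simp only [mem_setOf_eq, card_on_eq_stemCount H hω A]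

/-- `P_{w'}(c ↔ cyc j in core) = P_{w'}(stem j open)`. [this work] -/
theorem real_coreReach_cd_eq {j : ℕ} (hj : 1 ≤ j ∧ j < L) :
    (prodBernoulli (cdecouple L cyc S Z w)).real {ω | core Z (hubs (cpos L) S) ω ∈ openConn (cyc 0) (cyc j)} =
      (prodBernoulli (cdecouple L cyc S Z w)).real {ω | s(cyc 0, cyc j) ∈ ω} :=
  real_congr_cd H w _ _ fun ω hω => by simp only [mem_setOf_eq]; exact coreReach_iff_stem H hω hj

/-! ## Laws under the decoupled weights -/

/-- The hub laws are unchanged (any event read off a hub count). [this work] -/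
theorem real_hub_cdecouple (A : Finset (Fin n)) {j : ℕ} (hj : 1 ≤ j ∧ j < L) (P : ℕ → Prop) :
    (prodBernoulli (cdecouple L cyc S Z w)).real {ω | P (hubCount cyc S A j ω)} = (prodBernoulli w).real {ω | P (hubCount cyc S A j ω)} :=
  prodBernoulli_real_eq_of_determinedBy _ _ (fun _ he => cdecouple_hub H w hj (Finset.mem_coe.1 he)) ((readsOff_hubCount cyc S A j).determinedBy P)
    (Set.toFinite _).measurableSet

/-- **`P_{w'}(stem j open) = a_j + b_j − a_j b_j`** for a pendant-cycle weight `w`. [this work] -/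
theorem real_stem_open (hw : CycleHang L cyc S Z w) {j : ℕ} (hj : 1 ≤ j ∧ j < L) :
    (prodBernoulli (cdecouple L cyc S Z w)).real {ω | s(cyc 0, cyc j) ∈ ω} =
      cwProb L cyc w j + ccwProb L cyc w j - cwProb L cyc w j * ccwProb L cyc w j := by
  rw [prodBernoulli_real_setOf_mem, cdecouple_stem H w hj, ← real_RC w H hj.2.le, ← real_coreReach_cyc_eq H hw hj.2]
  rfl

end CycleBlock

end Block

end Quant

end Summit.CriticalPhenomena.PercolationContinuityZ3.Theorems
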